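import Summits.AtomisticToContinuum.FouriersLaw.Theses.OddSectorIrreversibility
import Literature.MathematicalPhysics.KineticTheory.LangevinChainHormander
import Literature.Analysis.Hypoelliptic.HormanderProof

/-!
# `OddDensityIsCorrector`, part 2: weak `L²(μ_T)` solutions of the resolvent equation are smooth

Helper file for support item `stmt-AtomisticToContinuum-9146`
(`OddSectorIrreversibility.OddDensityIsCorrector`).

For the equilibrium generator `L = L_{T,T}` of the pinned chain and `λ ∈ ℝ`, an integrable `k`
(with respect to the Gibbs measure `μ_T = Z⁻¹ e^{-H/T} dx`) such that
`∫ (λ F - L F) k dμ_T = 0` for every test function `F` is `μ_T`-a.e. (and Lebesgue-a.e.) equal to a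
SMOOTH function (`exists_contDiff_ae_eq_of_weak_resolvent`). Proof: the signed density `k e^{-H/T}`,
read as a distribution, solves `(L* - λ)(k e^{-H/T}) = 0` where the Fokker–Planck operator
`L* = X_L² + X_R² - Y + 2γ` is of Hörmander's form (1.6) with formal transpose `L`
(`hormanderTranspose_eq_generator`) and satisfies the bracket condition
(`isBracketGenerating_hormanderFamily`, CEHR Prop. 4.1); Hörmander's Theorem 1.1 — proved in the
tree, `Literature.Analysis.Hypoelliptic.hormander1967_thm11_proof` — makes it a smooth function, and
dividing by the smooth positive `e^{-H/T}` gives the smooth representative of `k`. This is the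
regularity input of the density of `Range(λ - L)|C_c^∞` in `L²(μ_T)` (energy estimate, next file).
Nothing here closes an item.
-/

noncomputable section

open MeasureTheory Filter Topology Set Function TopologicalSpace
open scoped ContDiff ENNReal Distributions
open Literature.MathematicalPhysics.KineticTheory.HeatConduction
open Literature.Analysis.Distribution

namespace Summit.AtomisticToContinuum.FouriersLaw.Theorems.OddSectorIrreversibility

variable {N : ℕ}

/-- The Gibbs density `e^{-H/T}` of a chain with smooth potentials is smooth. [folklore] -/
theorem contDiff_gibbsDensity (P : OscillatorChain) (hU : ContDiff ℝ ∞ P.U) (hV : ContDiff ℝ ∞ P.V)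
    (N : ℕ) (T : ℝ) : ContDiff ℝ ∞ (P.gibbsDensity N T) := by
  unfold OscillatorChain.gibbsDensity
  exact ((P.contDiff_hamiltonian hU hV N).neg.div_const T).exp

/-- `ᵗ(X_L² + X_R² - Y + c) φ = L φ + (c - 2γ) φ`: shifting the zeroth-order coefficient of the
Fokker–Planck operator by `-λ` subtracts `λ φ` from its formal transpose `L φ`. [folklore] -/
theorem hormanderTranspose_shift (P : OscillatorChain) (hU : ContDiff ℝ ∞ P.U) (hV : ContDiff ℝ ∞ P.V)
    (hN : 0 < N) {T_L T_R : ℝ} (hL : 0 ≤ P.γ * T_L) (hR : 0 ≤ P.γ * T_R) (lam' : ℝ)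
    {φ : PhaseSpace N → ℝ} (hφ : ContDiff ℝ ∞ φ) (x : PhaseSpace N) :
    hormanderTranspose (P.adjointDrift N) (P.bathField hN T_L T_R) (fun _ => 2 * P.γ - lam') φ x =
      P.generator N T_L T_R φ x - lam' * φ x := by
  have h := congrFun (P.hormanderTranspose_eq_generator hU hV hN hL hR hφ) x
  simp only [hormanderTranspose] at h ⊢
  linarith

/-- **Weak `L¹(μ_T)` solutions of `(λ - L)* k = 0` are smooth.** For the pinned chain
(`ω₂ > 0`, `lam, β ≥ 0`, `γ > 0`, `N ≥ 1`, `T > 0`), the equilibrium generator `L = L_{T,T}` and any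
real `λ`: if `k` is measurable, integrable for the Gibbs measure `μ_T`, and
`∫ (λ F - L F) k dμ_T = 0` for all `F ∈ C_c^∞`, then `k` agrees Lebesgue-a.e. and `μ_T`-a.e. with a
`C^∞` function. (The distribution `k e^{-H/T} dx` solves `(L* - λ)(k e^{-H/T}) = 0` for the
Hörmander-type Fokker–Planck operator `L*`; Hörmander 1967 Thm 1.1, proved in the tree, and the
fundamental lemma of the calculus of variations.) [cite: Hormander1967, Thm 1.1]
[cite: CuneoEckmannHairerReyBellet2018, Prop 3.2 and Prop 4.1] -/
theorem exists_contDiff_ae_eq_of_weak_resolvent {ω₂ lam β γ : ℝ} (hω : 0 < ω₂) (hl : 0 ≤ lam)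
    (hβ : 0 ≤ β) (hγ : 0 < γ) (hN : 0 < N) {T : ℝ} (hT : 0 < T) (lam' : ℝ)
    {k : PhaseSpace N → ℝ} (hkm : Measurable k)
    (hk : Integrable k ((pinnedChain ω₂ lam β γ).gibbsMeasure N T))
    (hweak : ∀ F : PhaseSpace N → ℝ, ContDiff ℝ ∞ F → HasCompactSupport F →
      ∫ x, (lam' * F x - (pinnedChain ω₂ lam β γ).generator N T T F x) * k x
        ∂((pinnedChain ω₂ lam β γ).gibbsMeasure N T) = 0) :
    ∃ g : PhaseSpace N → ℝ, ContDiff ℝ ∞ g ∧ k =ᵐ[volume] g ∧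
      k =ᵐ[(pinnedChain ω₂ lam β γ).gibbsMeasure N T] g := by
  set P := pinnedChain ω₂ lam β γ with hP
  have hU : ContDiff ℝ ∞ P.U := pinnedChain_contDiff_U ω₂ lam β γ
  have hV : ContDiff ℝ ∞ P.V := pinnedChain_contDiff_V ω₂ lam β γ
  have hγ' : P.γ = γ := rfl
  haveI := isAddHaarMeasure_volume_phaseSpace N
  set ρ : PhaseSpace N → ℝ := P.gibbsDensity N T with hρ
  have hρs : ContDiff ℝ ∞ ρ := contDiff_gibbsDensity P hU hV N T
  have hρc : Continuous ρ := hρs.continuous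
  have hρpos : ∀ x, 0 < ρ x := fun x => P.gibbsDensity_pos N T x
  have hint : Integrable ρ := pinnedChain_integrable_gibbsDensity hω hl hβ γ N hT
  have hZpos : 0 < ∫ x, ρ x := integral_exp_pos hint
  -- `m = k ρ` is Lebesgue integrable
  set m : PhaseSpace N → ℝ := fun x => k x * ρ x with hm
  have hmm : Measurable m := hkm.mul hρc.measurable
  have hmi : Integrable m := by
    have h1 := hk
    rw [P.gibbsMeasure_eq_smul_withDensity hint, integrable_smul_measure] at h1
    · rw [integrable_withDensity_iff_integrable_smul' hρc.measurable.ennreal_ofReal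
        (Eventually.of_forall fun _ => ENNReal.ofReal_lt_top)] at h1
      refine h1.congr (Eventually.of_forall fun x => ?_)
      simp only [hm, smul_eq_mul, ENNReal.toReal_ofReal (hρpos x).le, mul_comm]
    · exact ENNReal.inv_ne_zero.2 (P.partitionFunction_ne_top hint)
    · exact ENNReal.inv_ne_top.2 (P.partitionFunction_ne_zero hρc)
  -- the weak equation in Lebesgue form: `∫ (L φ - λ φ) m = 0`
  have hweak' : ∀ φ : PhaseSpace N → ℝ, ContDiff ℝ ∞ φ → HasCompactSupport φ →
      ∫ x, (P.generator N T T φ x - lam' * φ x) * m x = 0 := by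
    intro φ hφ hφc
    have h0 := hweak φ hφ hφc
    rw [P.integral_gibbsMeasure, mul_eq_zero] at h0
    rcases h0 with h0 | h0
    · exact absurd h0 (inv_ne_zero hZpos.ne')
    · have : (fun x => (P.generator N T T φ x - lam' * φ x) * m x) =
          fun x => -((lam' * φ x - P.generator N T T φ x) * k x * ρ x) := by
        funext x; simp only [hm]; ring
      rw [this, integral_neg, h0, neg_zero]
  -- the signed density as a distribution: difference of two finite measures
  set mp : Measure (PhaseSpace N) := volume.withDensity fun x => ENNReal.ofReal (m x) with hmp
  set mn : Measure (PhaseSpace N) := volume.withDensity fun x => ENNReal.ofReal (-m x) with hmn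
  haveI : IsFiniteMeasure mp := isFiniteMeasure_withDensity_ofReal hmi.hasFiniteIntegral
  haveI : IsFiniteMeasure mn := isFiniteMeasure_withDensity_ofReal hmi.neg.hasFiniteIntegral
  have hpair : ∀ φ : PhaseSpace N → ℝ, Continuous φ → HasCompactSupport φ →
      (∫ x, φ x ∂mp) - ∫ x, φ x ∂mn = ∫ x, φ x * m x := by
    intro φ hφ hφc
    obtain ⟨C, hC⟩ := hφ.bounded_above_of_compact_support hφc
    have hmm' : Measurable fun x => ENNReal.ofReal (-m x) := hmm.neg.ennreal_ofReal
    rw [hmp, hmn, integral_withDensity_eq_integral_toReal_smul hmm.ennreal_ofReal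
        (Eventually.of_forall fun _ => ENNReal.ofReal_lt_top),
      integral_withDensity_eq_integral_toReal_smul hmm'
        (Eventually.of_forall fun _ => ENNReal.ofReal_lt_top)]
    simp only [ENNReal.toReal_ofReal', smul_eq_mul]
    have i1 : Integrable (fun x => max (m x) 0 * φ x) :=
      hmi.pos_part.mul_bdd hφ.aestronglyMeasurable (Eventually.of_forall hC)
    have i2 : Integrable (fun x => max (-m x) 0 * φ x) :=
      hmi.neg_part.mul_bdd hφ.aestronglyMeasurable (Eventually.of_forall hC)
    rw [← integral_sub i1 i2]
    refine integral_congr_ae (Eventually.of_forall fun x => ?_)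
    have := max_zero_sub_max_neg_zero_eq_self (m x)
    calc max (m x) 0 * φ x - max (-m x) 0 * φ x = (max (m x) 0 - max (-m x) 0) * φ x := by ring
      _ = φ x * m x := by rw [this, mul_comm]
  set u : 𝓓'((⊤ : Opens (PhaseSpace N)), ℝ) :=
    measureDistribution mp ⊤ - measureDistribution mn ⊤ with hu
  have hu' : ∀ φ : 𝓓((⊤ : Opens (PhaseSpace N)), ℝ), u φ = ∫ x, φ x * m x := fun φ => by
    show measureDistribution mp ⊤ φ - measureDistribution mn ⊤ φ = _
    rw [measureDistribution_apply, measureDistribution_apply]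
    exact hpair φ φ.contDiff.continuous φ.hasCompactSupport
  -- Hörmander's theorem for `L* - λ`
  have hH := Literature.Analysis.Hypoelliptic.hormander1967_thm11_proof
  have hγT : 0 < P.γ * T := by rw [hγ']; positivity
  have hV2 : ∀ r, deriv (deriv P.V) r ≠ 0 := fun r => by
    rw [hP, pinnedChain_deriv_deriv_V]; positivity
  have hbr := P.isBracketGenerating_hormanderFamily hN T T hU hV hγT hV2
  have hyp := hH (PhaseSpace N) volume (Fin 2) ⊤ (P.adjointDrift N) (P.bathField hN T T)
    (fun _ => 2 * P.γ - lam') (P.contDiff_adjointDrift hU hV N) (fun _ => contDiff_const)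
    contDiff_const (fun x _ => hbr x (Set.mem_univ x))
  have hsm : Literature.Analysis.Distribution.IsSmoothOn u volume univ := by
    refine hyp u univ isOpen_univ (subset_univ _) ⟨0, contDiffOn_const, fun φ ψ _ hψ => ?_⟩
    simp only [Pi.zero_apply, zero_mul, integral_zero]
    rw [hu' ψ]
    have hψ' : ∀ x, ψ x = P.generator N T T φ x - lam' * φ x := fun x => by
      rw [show ψ x = hormanderTranspose (P.adjointDrift N) (P.bathField hN T T)
        (fun _ => 2 * P.γ - lam') φ x from congrFun hψ x]
      exact hormanderTranspose_shift P hU hV hN hγT.le hγT.le lam' φ.contDiff x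
    simp_rw [hψ']
    exact hweak' φ φ.contDiff φ.hasCompactSupport
  -- extract the smooth function and compare with `m`
  obtain ⟨g, hg, hgint⟩ := hsm
  rw [contDiffOn_univ] at hg
  have hmg : ∀ᵐ x ∂volume, m x = g x := by
    refine ae_eq_of_integral_contDiff_smul_eq hmi.locallyIntegrable
      hg.continuous.locallyIntegrable fun φ hφ hφc => ?_
    let ψ : 𝓓((⊤ : Opens (PhaseSpace N)), ℝ) := ⟨φ, hφ, hφc, fun _ _ => trivial⟩
    have h1 := hgint ψ (subset_univ _)
    rw [hu' ψ] at h1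
    simp only [smul_eq_mul]
    have e1 : ∫ x, φ x * m x = ∫ x, ψ x * m x := rfl
    rw [e1, h1]
    exact integral_congr_ae (Eventually.of_forall fun x => by show g x * ψ x = ψ x * g x; ring)
  refine ⟨fun x => g x / ρ x, hg.div hρs fun x => (hρpos x).ne', ?_, ?_⟩
  · filter_upwards [hmg] with x hx
    simp only [hm] at hx
    field_simp [(hρpos x).ne']
    linarith
  · refine (P.gibbsMeasure_absolutelyContinuous N T).ae_eq ?_
    filter_upwards [hmg] with x hx
    simp only [hm] at hx
    field_simp [(hρpos x).ne']
    linarith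

end Summit.AtomisticToContinuum.FouriersLaw.Theorems.OddSectorIrreversibility

end
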